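import Summits.HodgeConjecture.HodgeConjecture.Theorems.MarkmanPartnerTransportPicardThreeK3SquaresSqrtSixCycle

/-!
# Route MarkmanPartnerTransport · crux `PicardThreeK3Squares` (stmt-HodgeConjecture-19652) —
# the `√6`-SECTOR: HC⁴(S ⊗ S) for every projective K3 surface of Picard rank `≥ 15` whose `T(S)` carries
# a `√6`-similitude — every Picard-rank-`16` K3 surface with real multiplication by `ℚ(√6)`

A sector NOT in print (Varesco 2023 §2 treats `√2` and `√3` separately; here `√6 = √2·√3` via the two
quotient similitudes and one Buskin–Huybrechts isometry, `…SqrtSixCycle.sqrtSix_cycleInduced`). With the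
sector dichotomy at `ρ ≥ 12` (`sqrtSector_or_hasComplexMultiplication_of_natCast`, `q = 6`: either
`End_Hdg(T(S)) = ℚ + ℚψ` or `S` has CM) and the bookkeeping
`hodgeConjectureFor_square_of_corr_similitude` (an algebraic class acting as `ψ` on `T(S)` + the
sector clause ⟹ HC⁴):

* `hodgeConjectureFor_square_of_corr_similitude` — that bookkeeping (the `Corr` form of
  `SymplecticLocus.hodgeConjectureFor_square_of_algebraic_similitude`).
* `hodgeConjectureFor_square_of_fifteen_le_of_sqrtSix` (+ marking-free `'`) — **HC⁴(S ⊗ S) for every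
  (marked) projective K3 surface with `ρ(S) ≥ 15` and a rational Hodge endomorphism `ψ` of `H²(S)` with
  `ψ² = 6` and multiplier `6` on `T(S)`**, modulo the named facts
  `Varesco2023_quotientSimilitude_two/three_of_transcendental_embedding` (Varesco §2 + Prop. 2.5/2.11),
  `Huybrechts2019_transcendentalHodgeIsometry_algebraic`, `Buskin2019_hodgeIsometry_algebraic` (CM branch)
  and `Huybrechts_K3_marking_exists`.

No definition, no sorry. Prover seat hodge-nonav-19652-p1 (gen 4), `--supports stmt-HodgeConjecture-19652`.

References: M. Varesco, Math. Z. 305 (2023) §2; D. Huybrechts, Comment. Math. Helv. 94 (2019) Cor. 0.4;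
N. Buskin, J. reine angew. Math. 755 (2019); B. van Geemen, Michigan Math. J. 56 (2008), Lemma 3.2.
-/

set_option linter.dupNamespace false

noncomputable section

namespace Summit.HodgeConjecture.HodgeConjecture.Theorems.MarkmanPartnerTransport.SqrtSix

open scoped Manifold
open Module CategoryTheory MonoidalCategory CartesianMonoidalCategory
open Literature.AlgebraicGeometry Literature.AlgebraicGeometry.Motives Literature.AlgebraicGeometry.HodgeTheory
open Literature.AlgebraicGeometry.Surfaces
open Literature.AlgebraicTopology.SingularHomology
open Summit.HodgeConjecture.HodgeConjecture.Theorems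
open Summit.HodgeConjecture.HodgeConjecture.Theorems.NikulinTwinTransport
open Summit.HodgeConjecture.HodgeConjecture.Theorems.NikulinTwinTransport.SquareGlueFree
open Summit.HodgeConjecture.HodgeConjecture.Theorems.MarkmanPartnerTransport

variable {S : SchemeOver ℂ}

/-- `MarkedK3[S, η, p, x]`: VERBATIM the `let MarkedK3 := …` binder of the route declaration
`PicardThreeK3Squares`. Local notation only. -/
local notation3 (prettyPrint := false) "MarkedK3[" S ", " η ", " p ", " x "]" =>
  (p ≠ 0 ∧ (IsIntegralClass p ∧
    (∀ q : complexBetti S (2 * 2), IsIntegralClass q → ∃ n : ℤ, q = n • p) ∧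
    (∀ c : complexBetti S (2 * 1), IsIntegralClass c ↔ ∃ v : K3Index → ℤ, η c = fun i => (v i : ℂ)) ∧
    (∀ a b : complexBetti S (2 * 1),
      cupProduct (rfl : 2 * 1 + 2 * 1 = 2 * 2) a b = k3Form (η a) (η b) • p) ∧
    IsOfHodgeType 2 S (2 * 1) 2 0 (LinearEquiv.symm η x) ∧
    (∀ τ : complexBetti S (2 * 1), IsOfHodgeType 2 S (2 * 1) 2 0 τ →
      ∃ t : ℂ, τ = t • LinearEquiv.symm η x)) ∧
    (k3Form x x = 0 ∧ 0 < (k3Form (star x) x).re ∧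
      ∃ u : K3Index → ℤ, k3Form (fun i => (u i : ℂ)) x = 0 ∧ 0 < ∑ i, ∑ j, u i * k3Gram i j * u j))

/-- `Corr[μ, X, Y, hX, hY ; γ, y] = fst_* (snd^* y ∪ γ)` (`hX hY : IsSmoothProjective 2 _`). Local notation only. -/
local notation3 (prettyPrint := false) "Corr[" μ ", " X ", " Y ", " hX ", " hY " ; " γ ", " y "]" =>
  complexGysin μ (IsSmoothProjective.tensor_holds hX hY) hX (SemiCartesianMonoidalCategory.fst X Y)
    (rfl : 2 * 1 + 2 * 2 + 2 * 2 = 2 * 1 + 2 * (2 + 2))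
    (cupProduct (rfl : 2 * 1 + 2 * 2 = 2 * 1 + 2 * 2)
      (complexBetti.map (SemiCartesianMonoidalCategory.snd X Y) (2 * 1) y) γ)

/-! ### Bookkeeping: a class acting as `ψ` on `T(S)` + the sector clause ⟹ HC⁴ -/

/-- **An algebraic class on `S × S` acting as `ψ` on `T(S)`, plus the sector clause
`End_Hdg(T(S)) ⊆ ℚ + ℚψ`, give HC⁴(S ⊗ S)** (the `Corr` form of
`SymplecticLocus.hodgeConjectureFor_square_of_algebraic_similitude`; same proof).
[cite: Varesco2023, §2 (p. 8)] [cite: Fulton1998, §16.1 Prop. 16.1.1] -/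
theorem hodgeConjectureFor_square_of_corr_similitude (hS : IsK3Surface S)
    (ψ T₀ : complexBetti S (2 * 1) →ₗ[ℂ] complexBetti S (2 * 1)) (γ : complexBetti (S ⊗ S) (2 * 2))
    (hγalg : γ ∈ algebraicClasses (S ⊗ S) 2)
    (hγ : ∀ y, T₀ y = Corr[complexOrientationFamily, S, S, hS.1, hS.1 ; γ, y])
    (hT₀ψ : ∀ x ∈ transcendentalSubspace S, T₀ x = ψ x)
    (hU : ∀ (f : complexBetti S (2 * 1) →ₗ[ℂ] complexBetti S (2 * 1)),
      (∀ y, IsRationalClass y → IsRationalClass (f y)) →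
      (∀ (i j : ℕ) y, IsOfHodgeType 2 S (2 * 1) i j y → IsOfHodgeType 2 S (2 * 1) i j (f y)) →
      (∀ d ∈ algebraicClasses S 1, f d = 0) →
      (∀ y : complexBetti S (2 * 1), ∀ d ∈ algebraicClasses S 1,
        cupProduct (rfl : 2 * 1 + 2 * 1 = 2 * 2) (f y) d = 0) →
      ∃ a b : ℚ, ∀ y : complexBetti S (2 * 1),
        (∀ d ∈ algebraicClasses S 1, cupProduct (rfl : 2 * 1 + 2 * 1 = 2 * 2) y d = 0) →
        f y = (a : ℂ) • y + (b : ℂ) • ψ y) :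
    HodgeConjectureFor 4 (S ⊗ S) := by
  have h4 : 2 * 1 + 2 * 1 = 2 * 2 := rfl
  set μ : OrientationFamily := complexOrientationFamily with hμdef
  obtain ⟨Q, γQ, hγQalg, hQ, hQN, hQT⟩ :=
    SymplecticLocus.exists_corr_transcendentalProjector μ hS.isSmoothProjective
  obtain ⟨γ₂, hγ₂alg, hγ₂⟩ := corrComp_surfaces_of_cup μ
    SquareOfGenerator.cupProduct_mem_algebraicClasses_tripleProduct S S S hS.isSmoothProjective
    hS.isSmoothProjective hS.isSmoothProjective γ hγalg γQ hγQalg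
  set δ : complexBetti (S ⊗ S) (2 * 2) :=
    complexGysin μ hS.isSmoothProjective (IsSmoothProjective.tensor_holds hS.isSmoothProjective hS.isSmoothProjective)
      (lift (𝟙 S) (𝟙 S)) (rfl : 0 + 2 * (2 + 2) = 2 * 2 + 2 * 2) (singularCohomology.one ℂ (ComplexPoints S))
    with hδdef
  have hδalg : δ ∈ algebraicClasses (S ⊗ S) 2 := diagonal_mem_algebraicClasses μ hS.isSmoothProjective _
  have hδact : ∀ y : complexBetti S (2 * 1), Corr[μ, S, S, hS.1, hS.1 ; δ, y] = y := fun y ↦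
    corrFst_diagonal μ hS.isSmoothProjective (rfl : 2 * 1 + 2 * 2 = 2 * 1 + 2 * 2)
      (rfl : 2 * 1 + 2 * 2 + 2 * 2 = 2 * 1 + 2 * (2 + 2)) (rfl : 0 + 2 * (2 + 2) = 2 * 2 + 2 * 2) y
  have hmemT : ∀ y : complexBetti S (2 * 1),
      (∀ d ∈ algebraicClasses S 1, cupProduct h4 y d = 0) → y ∈ transcendentalSubspace S := by
    intro y hy
    rw [mem_transcendentalSubspace_iff]
    intro c hc
    rw [cupProduct_gradedComm_holds ℂ _ h4 h4, hy c hc.2, smul_zero]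
  refine CycleInducedSector.hodgeConjectureFor_square_of_cycleInducedSector μ hS.isSmoothProjective
    fun f hf₁ hf₂ hf₃ hf₄ ↦ ?_
  obtain ⟨a, b, hab⟩ := hU f hf₁ hf₂ hf₃ hf₄
  refine ⟨(a : ℂ) • LinearMap.id + (b : ℂ) • (T₀ ∘ₗ Q), fun d hd ↦ ?_,
    ⟨(a : ℂ) • δ + (b : ℂ) • γ₂, Submodule.add_mem _ (Submodule.smul_mem _ _ hδalg)
      (Submodule.smul_mem _ _ hγ₂alg), fun y ↦ ?_⟩, fun y hy ↦ ?_⟩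
  · rw [LinearMap.add_apply, LinearMap.smul_apply, LinearMap.smul_apply, LinearMap.id_apply,
      LinearMap.comp_apply, hQN d hd, map_zero, smul_zero, add_zero]
    exact Submodule.smul_mem _ _ hd
  · rw [LinearMap.add_apply, LinearMap.smul_apply, LinearMap.smul_apply, LinearMap.id_apply,
      LinearMap.comp_apply, map_add, map_smul, map_smul, map_add, map_smul, map_smul, hδact, hγ₂ y, ← hQ y,
      ← hγ (Q y)]
  · rw [hab y hy, LinearMap.add_apply, LinearMap.smul_apply, LinearMap.smul_apply, LinearMap.id_apply,
      LinearMap.comp_apply, hQT y hy, hT₀ψ y (hmemT y hy)]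

/-- **HC⁴(S ⊗ S) for every marked projective K3 surface with `ρ(S) ≥ 15` whose `H²` carries a rational
Hodge endomorphism `ψ` with `ψ² = 6` and multiplier `6` on `T(S)`** — e.g. EVERY projective K3 surface of
Picard rank `16` with real multiplication by `ℚ(√6)`, a sector with no printed source — modulo
`Varesco2023_quotientSimilitude_two/three_of_transcendental_embedding`,
`Huybrechts2019_transcendentalHodgeIsometry_algebraic`, `Buskin2019_hodgeIsometry_algebraic` (CM branch)
and `Huybrechts_K3_marking_exists`. Proof: either `S` has CM (Buskin:
`CMThird.hodgeConjectureFor_square_of_CM_of_buskin`) or the `√6`-sector data hold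
(`sqrtSector_or_hasComplexMultiplication_of_natCast`, `q = 6`); then `ψ` is cycle-induced
(`sqrtSix_cycleInduced`) and `hodgeConjectureFor_square_of_corr_similitude` concludes.
[cite: Varesco2023, §2, Prop. 2.5 and Prop. 2.11] [cite: Huybrechts2019, Cor. 0.4 (i)]
[cite: Vangeemen2008, Lemma 3.2] [cite: Buskin2019, Thm. 1.1 and Corollary] -/
theorem hodgeConjectureFor_square_of_fifteen_le_of_sqrtSix (hB : Buskin2019_hodgeIsometry_algebraic)
    (hmark : Huybrechts_K3_marking_exists)
    (hQ2 : Varesco2023_quotientSimilitude_two_of_transcendental_embedding)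
    (hQ3 : Varesco2023_quotientSimilitude_three_of_transcendental_embedding)
    (hH : Huybrechts2019_transcendentalHodgeIsometry_algebraic)
    (hS : IsK3Surface S)
    (η : complexBetti S (2 * 1) ≃ₗ[ℂ] (K3Index → ℂ)) (p : complexBetti S (2 * 2)) (x : K3Index → ℂ)
    (hM : MarkedK3[S, η, p, x]) (hρ : 15 ≤ Module.finrank ℂ ↥(algebraicClasses S 1))
    (ψ : complexBetti S (2 * 1) →ₗ[ℂ] complexBetti S (2 * 1))
    (hψrat : ∀ y, IsRationalClass y → IsRationalClass (ψ y))
    (hψtyp : ∀ (i j : ℕ) y, IsOfHodgeType 2 S (2 * 1) i j y → IsOfHodgeType 2 S (2 * 1) i j (ψ y))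
    (hψsq : ∀ y ∈ transcendentalSubspace S, ψ (ψ y) = (6 : ℂ) • y)
    (hψmul : ∀ y ∈ transcendentalSubspace S, ∀ z ∈ transcendentalSubspace S,
      cupProduct (rfl : 2 * 1 + 2 * 1 = 2 * 2) (ψ y) (ψ z) =
        (6 : ℂ) • cupProduct (rfl : 2 * 1 + 2 * 1 = 2 * 2) y z) :
    HodgeConjectureFor 4 (S ⊗ S) := by
  have h6 : ¬ IsSquare (6 : ℕ) := by
    rintro ⟨r, hr⟩
    have hr3 : r < 3 := by nlinarith
    interval_cases r <;> omega
  rcases NikulinIsogeny.sqrtSector_or_hasComplexMultiplication_of_natCast h6 hS η p x hM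
      (by omega) ψ hψrat hψtyp (fun y hy ↦ by simpa using hψsq y hy)
      (fun y hy z hz ↦ by simpa using hψmul y hy z hz) with hsec | hCM
  · obtain ⟨hψT, -, -, -, -, hU⟩ := hsec
    obtain ⟨γ, hγalg, hγ⟩ := sqrtSix_cycleInduced hQ2 hQ3 hH hS η p x hM hρ ψ hψT hψrat hψtyp hψsq hψmul
    exact hodgeConjectureFor_square_of_corr_similitude hS ψ
      ((complexGysin complexOrientationFamily (IsSmoothProjective.tensor_holds hS.1 hS.1) hS.1
          (SemiCartesianMonoidalCategory.fst S S) (rfl : 2 * 1 + 2 * 2 + 2 * 2 = 2 * 1 + 2 * (2 + 2))) ∘ₗ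
        ((cupProduct (rfl : 2 * 1 + 2 * 2 = 2 * 1 + 2 * 2)).flip γ) ∘ₗ
        (complexBetti.map (SemiCartesianMonoidalCategory.snd S S) (2 * 1)).hom)
      γ hγalg (fun _ ↦ rfl) (fun z hz ↦ hγ z hz) hU
  · exact CMThird.hodgeConjectureFor_square_of_CM_of_buskin hB hmark S hS hCM

/-- **Marking-free form: every projective K3 surface of Picard rank `≥ 15` whose `H²` carries a rational
Hodge endomorphism `ψ` with `ψ² = 6` and multiplier `6` on `T(S)` (real multiplication by `√6`) satisfies
the Hodge conjecture for `S ⊗ S`**, modulo the five named facts. [cite: Varesco2023, §2, Prop. 2.5 and Prop. 2.11]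
[cite: Huybrechts2019, Cor. 0.4 (i)] [cite: Vangeemen2008, Lemma 3.2] -/
theorem hodgeConjectureFor_square_of_fifteen_le_of_sqrtSix' (hB : Buskin2019_hodgeIsometry_algebraic)
    (hmark : Huybrechts_K3_marking_exists)
    (hQ2 : Varesco2023_quotientSimilitude_two_of_transcendental_embedding)
    (hQ3 : Varesco2023_quotientSimilitude_three_of_transcendental_embedding)
    (hH : Huybrechts2019_transcendentalHodgeIsometry_algebraic)
    (hS : IsK3Surface S) (hρ : 15 ≤ Module.finrank ℂ ↥(algebraicClasses S 1))
    (ψ : complexBetti S (2 * 1) →ₗ[ℂ] complexBetti S (2 * 1))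
    (hψrat : ∀ y, IsRationalClass y → IsRationalClass (ψ y))
    (hψtyp : ∀ (i j : ℕ) y, IsOfHodgeType 2 S (2 * 1) i j y → IsOfHodgeType 2 S (2 * 1) i j (ψ y))
    (hψsq : ∀ y ∈ transcendentalSubspace S, ψ (ψ y) = (6 : ℂ) • y)
    (hψmul : ∀ y ∈ transcendentalSubspace S, ∀ z ∈ transcendentalSubspace S,
      cupProduct (rfl : 2 * 1 + 2 * 1 = 2 * 2) (ψ y) (ψ z) =
        (6 : ℂ) • cupProduct (rfl : 2 * 1 + 2 * 1 = 2 * 2) y z) :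
    HodgeConjectureFor 4 (S ⊗ S) := by
  obtain ⟨η, p, x, hM⟩ := hmark S hS
  exact hodgeConjectureFor_square_of_fifteen_le_of_sqrtSix hB hmark hQ2 hQ3 hH hS η p x hM hρ ψ hψrat hψtyp
    hψsq hψmul

end Summit.HodgeConjecture.HodgeConjecture.Theorems.MarkmanPartnerTransport.SqrtSix

end
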